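import Mathlib
import HarnessLib
import Literature.NumberTheory.Transcendental.KZProductIdeal
import Literature.NumberTheory.Transcendental.KZLogCalculusProofs
import Literature.NumberTheory.Transcendental.KZDominatedFamilyRelations
import Literature.NumberTheory.Transcendental.KZUnfoldedStokesProofs
import Literature.NumberTheory.Transcendental.SemialgebraicLineDeriv

/-!
# Stub `stub_boundedStokesMove` of line `tame-bv-stokes` (crux `DihedralNormalForm`)

STOKES ON THE OPEN CUBE AS KONTSEVICH–ZAGIER MOVES. Data: `h : Fin (k+1) → (ℝ^{k+1} → ℝ)`,
each `h i` `ℚ`-semialgebraic on the closed cube `[0,1]^{k+1}`, bounded by `C` on the open cube,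
differentiable at each point of the open cube, and `t ↦ h i (insertNth i t y)` continuous on
`[0,1]` for every `y` in the open `k`-cube; `r` is a representation on the open cube with
integrand `Σᵢ ∂ᵢhᵢ`; `f₀ i`, `f₁ i` are representations on the open `k`-cube with integrands
`y ↦ h i (insertNth i 0 y)`, `y ↦ h i (insertNth i 1 y)`. Claim (GIVEN the tame
bounded-variation statement `stub_bvStokes` as the first hypothesis, which makes every `∂ᵢhᵢ`
absolutely integrable on the open cube): `[r] − Σᵢ ([f₁ i] − [f₀ i]) ∈ KZ.relations`.

Chain of moves:
* rule (1b), iterated (`KZ.of_sub_of_sub_sum_mem_relations`): `[r] ∼ Σᵢ [Q, 𝟙_Q ∂ᵢhᵢ]`, `Q`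
  the open cube (`∂ᵢhᵢ` is `ℚ`-semialgebraic on `Q` by
  `IsSemialgebraicFunOn.fderiv_apply_single`);
* for each `i` (`face_move`): the open cube is, up to the two null faces `xᵢ ∈ {0,1}`, the slab
  `{xᵢ ∈ [0,1], other coordinates in (0,1)}` (rule (1a),
  `KZ.IntegralRep.of_sub_of_restrict_mem_relations`), which read through the coordinate
  permutation `e` with `e i = last`, `e (i.succAbove m) = castSucc m` (rule (2),
  `KZ.of_sub_of_reindex_mem_relations`) is the band `(0,1)^k × [0,1]`; there ONE
  Newton–Leibniz move (rule (3)) with primitive `hᵢ` read through `e` lands on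
  `[(0,1)^k, hᵢ(insertNth i 1 ·) − hᵢ(insertNth i 0 ·)]`, which is `[f₁ i] − [f₀ i]` by
  rule (1b).

No definition and no named fact is introduced.
-/

noncomputable section

open MeasureTheory Set

namespace Summit.KontsevichZagierPeriods.DihedralNormalForm.TameBVStokes

open Literature.NumberTheory.Transcendental Literature.ModelTheory.ExponentialFields

/-- Reading a vector `w` through the coordinate permutation
`e = (finSuccEquiv' i).trans finSuccEquivLast.symm` (`e i = last`,
`e (i.succAbove m) = castSucc m`) inserts its last coordinate at slot `i`:
`(w ∘ e) = insertNth i (w last) (init w)`. -/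
private theorem comp_moveLast {k : ℕ} (i : Fin (k + 1)) (w : Fin (k + 1) → ℝ) :
    (fun j => w (((finSuccEquiv' i).trans finSuccEquivLast.symm) j)) =
      i.insertNth (w (Fin.last k)) (Fin.init w) := by
  ext j
  refine Fin.succAboveCases i ?_ (fun m => ?_) j
  · simp [Fin.insertNth_apply_same]
  · simp [Fin.insertNth_apply_succAbove, Fin.init]

/-- Reading a vector `x` through `e.symm` moves the coordinate `i` to the last slot:
`x ∘ e.symm = snoc (removeNth i x) (x i)`. -/
private theorem comp_moveLast_symm {k : ℕ} (i : Fin (k + 1)) (x : Fin (k + 1) → ℝ) :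
    (x ∘ ⇑((finSuccEquiv' i).trans finSuccEquivLast.symm).symm) =
      Fin.snoc (i.removeNth x) (x i) := by
  ext j
  refine Fin.lastCases ?_ (fun m => ?_) j
  · simp
  · simp [Fin.removeNth_apply]

/-- **One face of Stokes on the open cube as KZ moves.** For `g` `ℚ`-semialgebraic on the
closed cube, differentiable on the open cube `Q` with `∂ᵢg` absolutely integrable on `Q`, and
with `t ↦ g (insertNth i t y)` continuous on `[0,1]` for `y` in the open `k`-cube, the
representation `[Q, 𝟙_Q ∂ᵢg]` differs from `[f₁] − [f₀]` (`fᵥ = [(0,1)^k, g (insertNth i v ·)]`)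
by a relation: restriction off the two null faces `xᵢ ∈ {0,1}` (rule 1a), the reindexing `e`
moving the coordinate `i` last (rule 2; `e` enters only through the two identities `hσ`,
`hσ'`), one Newton–Leibniz move with primitive `g ∘ e` over the base `(0,1)^k` with `a = 0`,
`b = 1` (rule 3), and integrand additivity on the base (rule 1b). -/
private theorem face_move {k : ℕ} (i : Fin (k + 1)) (e : Fin (k + 1) ≃ Fin (k + 1))
    (hσ : ∀ w : Fin (k + 1) → ℝ, (fun j => w (e j)) = i.insertNth (w (Fin.last k)) (Fin.init w))
    (hσ' : ∀ x : Fin (k + 1) → ℝ, (x ∘ ⇑e.symm) = Fin.snoc (i.removeNth x) (x i))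
    {g : (Fin (k + 1) → ℝ) → ℝ}
    (hsa : IsSemialgebraicFunOn ℚ {x : Fin (k + 1) → ℝ | ∀ j, x j ∈ Icc (0:ℝ) 1} g)
    (hdiff : ∀ x ∈ KZ.unitCube (k + 1), DifferentiableAt ℝ g x)
    (hcont : ∀ y ∈ KZ.unitCube k, ContinuousOn (fun t : ℝ => g (i.insertNth t y)) (Icc 0 1))
    (hint : IntegrableOn (fun x => fderiv ℝ g x (Pi.single i 1)) (KZ.unitCube (k + 1)))
    (f₀ f₁ : KZ.IntegralRep k) (hf₀d : f₀.domain = KZ.unitCube k)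
    (hf₁d : f₁.domain = KZ.unitCube k)
    (hf₀i : EqOn f₀.integrand (fun y => g (i.insertNth 0 y)) (KZ.unitCube k))
    (hf₁i : EqOn f₁.integrand (fun y => g (i.insertNth 1 y)) (KZ.unitCube k)) :
    ∃ R : KZ.IntegralRep (k + 1), R.domain = KZ.unitCube (k + 1) ∧
      R.integrand = (KZ.unitCube (k + 1)).indicator (fun x => fderiv ℝ g x (Pi.single i 1)) ∧
      KZ.of R - (KZ.of f₁ - KZ.of f₀) ∈ KZ.relations := by
  have hσs : ∀ (y : Fin k → ℝ) (t : ℝ),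
      (fun j => (Fin.snoc y t : Fin (k + 1) → ℝ) (e j)) = i.insertNth t y := by
    intro y t
    rw [hσ, Fin.snoc_last, Fin.init_snoc]
  -- semialgebraic bookkeeping
  have hQsa : IsSemialgebraic ℚ (KZ.unitCube (k + 1)) := KZ.isSemialgebraic_unitCube _
  have hBsa : IsSemialgebraic ℚ (KZ.unitCube k) := KZ.isSemialgebraic_unitCube _
  have hQm : MeasurableSet (KZ.unitCube (k + 1)) := (KZ.isOpen_unitCube _).measurableSet
  have ha0 : IsSemialgebraicFunOn ℚ (KZ.unitCube k) (fun _ => (0 : ℝ)) := by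
    simpa using isSemialgebraicFunOn_ratCast hBsa 0
  have hb1 : IsSemialgebraicFunOn ℚ (KZ.unitCube k) (fun _ => (1 : ℝ)) := by
    simpa using isSemialgebraicFunOn_ratCast hBsa 1
  have hband : IsSemialgebraic ℚ (KZlog.band (KZ.unitCube k) (fun _ => 0) (fun _ => 1)) :=
    KZlog.isSemialgebraic_band ha0 hb1
  -- the slab `{x | xᵢ ∈ [0,1], the other coordinates in (0,1)}`, as the preimage of the band
  set slab : Set (Fin (k + 1) → ℝ) := (fun x : Fin (k + 1) → ℝ => x ∘ ⇑e.symm) ⁻¹'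
    KZlog.band (KZ.unitCube k) (fun _ => 0) (fun _ => 1) with hslab
  have hslab_sa : IsSemialgebraic ℚ slab := hband.preimage_comp _
  have hmem_slab : ∀ x, x ∈ slab ↔ i.removeNth x ∈ KZ.unitCube k ∧ x i ∈ Icc (0:ℝ) 1 :=
    fun x => by rw [hslab, mem_preimage, hσ', KZlog.snoc_mem_band]
  have hQslab : KZ.unitCube (k + 1) ⊆ slab := fun x hx => by
    rw [hmem_slab]
    have hx' := (KZ.mem_unitCube_succ_iff i x).1 hx
    exact ⟨hx'.2, Ioo_subset_Icc_self hx'.1⟩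
  have hnull : volume (slab \ KZ.unitCube (k + 1)) = 0 := by
    have hcov : slab \ KZ.unitCube (k + 1) ⊆
        {x : Fin (k + 1) → ℝ | x i = 0} ∪ {x : Fin (k + 1) → ℝ | x i = 1} := by
      rintro x ⟨hxs, hxQ⟩
      rw [hmem_slab] at hxs
      rw [KZ.mem_unitCube_succ_iff i] at hxQ
      obtain ⟨hxB, h0, h1⟩ := hxs
      rcases h0.lt_or_eq with h0 | h0
      · rcases h1.lt_or_eq with h1 | h1
        · exact absurd ⟨⟨h0, h1⟩, hxB⟩ hxQ
        · exact Or.inr h1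
      · exact Or.inl h0.symm
    refine measure_mono_null hcov (measure_union_null ?_ ?_)
    · rw [volume_pi]; exact Measure.pi_hyperplane _ _ _
    · rw [volume_pi]; exact Measure.pi_hyperplane _ _ _
  -- the integrand `D = 𝟙_Q ∂ᵢg` on the slab
  set D : (Fin (k + 1) → ℝ) → ℝ :=
    (KZ.unitCube (k + 1)).indicator fun x => fderiv ℝ g x (Pi.single i 1) with hD
  have hD'sa : IsSemialgebraicFunOn ℚ (KZ.unitCube (k + 1))
      fun x => fderiv ℝ g x (Pi.single i 1) :=
    (hsa.mono (fun x hx j => Ioo_subset_Icc_self (KZ.mem_unitCube.1 hx j))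
      hQsa).fderiv_apply_single (KZ.isOpen_unitCube _) hdiff i
  have hDsa : IsSemialgebraicFunOn ℚ slab D := by
    have h0 : IsSemialgebraicFunOn ℚ (slab \ KZ.unitCube (k + 1)) (fun _ => (0 : ℝ)) := by
      simpa using isSemialgebraicFunOn_ratCast (hslab_sa.diff hQsa) 0
    have h : IsSemialgebraicFunOn ℚ (KZ.unitCube (k + 1) ∪ slab \ KZ.unitCube (k + 1)) D :=
      IsSemialgebraicFunOn.union hD'sa h0 (fun x hx => by rw [hD]; exact indicator_of_mem hx _)
        (fun x hx => by rw [hD]; exact indicator_of_notMem hx.2 _)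
    rwa [union_sdiff_cancel hQslab] at h
  have hDint : IntegrableOn D slab := ((integrable_indicator_iff hQm).2 hint).integrableOn
  let S : KZ.IntegralRep (k + 1) := ⟨slab, D, hslab_sa, hDsa, hDint⟩
  let R : KZ.IntegralRep (k + 1) := S.restrict (KZ.unitCube (k + 1)) hQsa hQslab
  -- rule (1a): `[slab, D] ∼ [Q, D]`; rule (2): `[slab, D] ∼ [slab, D].reindex e`
  have h1 : KZ.of S - KZ.of R ∈ KZ.relations :=
    S.of_sub_of_restrict_mem_relations hQsa hQslab hnull
  have h2 : KZ.of S - KZ.of (S.reindex e) ∈ KZ.relations := KZ.of_sub_of_reindex_mem_relations S e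
  -- the reindexed slab is the band `(0,1)^k × [0,1]`
  have hdom : (S.reindex e).domain = KZlog.band (KZ.unitCube k) (fun _ => 0) (fun _ => 1) := by
    ext w
    show ((fun j => w (e j)) ∘ ⇑e.symm) ∈ KZlog.band (KZ.unitCube k) (fun _ => 0) (fun _ => 1) ↔ _
    have : ((fun j => w (e j)) ∘ ⇑e.symm) = w := by ext j; simp
    rw [this]
  -- the base, read off from `f₀`, `f₁`
  have h1sa : IsSemialgebraicFunOn ℚ (KZ.unitCube k) (fun y => g (i.insertNth 1 y)) := by
    have h := f₁.isSemialgebraicFunOn_integrand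
    rw [hf₁d] at h
    exact h.congr hf₁i
  have h0sa : IsSemialgebraicFunOn ℚ (KZ.unitCube k) (fun y => g (i.insertNth 0 y)) := by
    have h := f₀.isSemialgebraicFunOn_integrand
    rw [hf₀d] at h
    exact h.congr hf₀i
  have h1int : IntegrableOn (fun y => g (i.insertNth 1 y)) (KZ.unitCube k) := by
    have h := f₁.integrableOn
    rw [hf₁d] at h
    exact h.congr_fun hf₁i (KZ.isOpen_unitCube _).measurableSet
  have h0int : IntegrableOn (fun y => g (i.insertNth 0 y)) (KZ.unitCube k) := by
    have h := f₀.integrableOn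
    rw [hf₀d] at h
    exact h.congr_fun hf₀i (KZ.isOpen_unitCube _).measurableSet
  let Y : KZ.IntegralRep k := ⟨KZ.unitCube k, fun y => g (i.insertNth 1 y) - g (i.insertNth 0 y),
    hBsa, IsSemialgebraicFunOn.sub_holds h1sa h0sa, h1int.sub h0int⟩
  -- rule (3): the Newton–Leibniz move with primitive `F = g ∘ e` over `(0,1)^k`, `a = 0`, `b = 1`
  set F : (Fin (k + 1) → ℝ) → ℝ := fun w => g (fun j => w (e j))
  have hFsa : IsSemialgebraicFunOn ℚ (S.reindex e).domain F := by
    rw [hdom]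
    refine (hsa.comp_equiv e).mono (fun w hw => ?_) hband
    show (fun j => w (e j)) ∈ {x : Fin (k + 1) → ℝ | ∀ j, x j ∈ Icc (0:ℝ) 1}
    rw [hσ w]
    simp only [mem_setOf_eq, Fin.forall_iff_succAbove i, Fin.insertNth_apply_same,
      Fin.insertNth_apply_succAbove]
    exact ⟨⟨hw.2.1, hw.2.2⟩, fun m => Ioo_subset_Icc_self (hw.1 m)⟩
  have h3 : KZ.of (S.reindex e) - KZ.of Y ∈ KZ.relations := by
    refine KZ.newtonLeibnizRel_subset_relations ⟨k, S.reindex e, Y, fun _ => 0, fun _ => 1, F,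
      hFsa, ha0, hb1, fun _ _ => zero_le_one, hdom, fun y hy => ?_, fun y hy t ht => ?_,
      fun y _ => ?_, rfl⟩
    · show ContinuousOn (fun t : ℝ => g (fun j => (Fin.snoc y t : Fin (k + 1) → ℝ) (e j)))
        (Icc 0 1)
      simp only [hσs]
      exact hcont y hy
    · show HasDerivAt (fun s : ℝ => g (fun j => (Fin.snoc y s : Fin (k + 1) → ℝ) (e j)))
        (D (fun j => (Fin.snoc y t : Fin (k + 1) → ℝ) (e j))) t
      have hx : (i.insertNth t y : Fin (k + 1) → ℝ) ∈ KZ.unitCube (k + 1) := by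
        rw [KZ.mem_unitCube_succ_iff i, Fin.insertNth_apply_same, Fin.removeNth_insertNth]
        exact ⟨ht, hy⟩
      simp only [hσs, hD, indicator_of_mem hx]
      exact (hdiff _ hx).hasFDerivAt.comp_hasDerivAt t (KZ.hasDerivAt_insertNth i y t)
    · show g (i.insertNth 1 y) - g (i.insertNth 0 y) =
        g (fun j => (Fin.snoc y (1:ℝ) : Fin (k + 1) → ℝ) (e j)) -
          g (fun j => (Fin.snoc y (0:ℝ) : Fin (k + 1) → ℝ) (e j))
      rw [hσs, hσs]
  -- rule (1b) on the base: `[f₁] = [Y] + [f₀]`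
  have h4 : KZ.of f₁ - KZ.of Y - KZ.of f₀ ∈ KZ.relations := by
    refine KZ.integrandAddRel_subset_relations ⟨k, f₁, Y, f₀, ?_, ?_, fun y hy => ?_, rfl⟩
    · show KZ.unitCube k = f₁.domain
      rw [hf₁d]
    · rw [hf₀d, hf₁d]
    · rw [hf₁d] at hy
      show f₁.integrand y = (g (i.insertNth 1 y) - g (i.insertNth 0 y)) + f₀.integrand y
      rw [hf₁i hy, hf₀i hy]
      ring
  refine ⟨R, rfl, rfl, ?_⟩
  have : KZ.of R - (KZ.of f₁ - KZ.of f₀) = -(KZ.of S - KZ.of R) + (KZ.of S - KZ.of (S.reindex e)) +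
      (KZ.of (S.reindex e) - KZ.of Y) - (KZ.of f₁ - KZ.of Y - KZ.of f₀) := by
    abel
  rw [this]
  exact KZ.relations.sub_mem (KZ.relations.add_mem (KZ.relations.add_mem
    (KZ.relations.neg_mem h1) h2) h3) h4

/-- **stub_boundedStokesMove** (Stokes on the open cube as moves). For bounded `ℚ`-semialgebraic
`hᵢ` (semialgebraic on the closed cube, differentiable inside, continuous on each closed
`i`-fibre) the representation of `Σᵢ ∂ᵢhᵢ` on the open cube minus
`Σᵢ ([□ᵏ, hᵢ|_{xᵢ=1}] − [□ᵏ, hᵢ|_{xᵢ=0}])` is a relation, GIVEN the tame bounded-variation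
statement (the first hypothesis; it makes each `∂ᵢhᵢ` absolutely integrable on the open cube):
iterated integrand additivity (rule 1b, with `∂ᵢhᵢ` semialgebraic on the open cube by
`IsSemialgebraicFunOn.fderiv_apply_single`), then face by face `face_move` (rules 1a, 2, 3, 1b). -/
theorem stub_boundedStokesMove : (∀ (k : ℕ) (i : Fin (k + 1)) (h : (Fin (k + 1) → ℝ) → ℝ) (C : ℝ), Literature.NumberTheory.Transcendental.IsSemialgebraicFunOn ℚ {x : Fin (k + 1) → ℝ | ∀ i, x i ∈ Set.Ioo (0:ℝ) 1} h → (∀ x ∈ {x : Fin (k + 1) → ℝ | ∀ i, x i ∈ Set.Ioo (0:ℝ) 1}, |h x| ≤ C) → (∀ x ∈ {x : Fin (k + 1) → ℝ | ∀ i, x i ∈ Set.Ioo (0:ℝ) 1}, DifferentiableAt ℝ h x) → MeasureTheory.IntegrableOn (fun x => fderiv ℝ h x (Pi.single i 1)) {x : Fin (k + 1) → ℝ | ∀ i, x i ∈ Set.Ioo (0:ℝ) 1}) → ∀ (k : ℕ) (h : Fin (k + 1) → (Fin (k + 1) → ℝ) → ℝ) (C : ℝ) (r : Literature.NumberTheory.Transcendental.KZ.IntegralRep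 (k + 1)) (f₀ f₁ : Fin (k + 1) → Literature.NumberTheory.Transcendental.KZ.IntegralRep k), (∀ i, Literature.NumberTheory.Transcendental.IsSemialgebraicFunOn ℚ {x : Fin (k + 1) → ℝ | ∀ i, x i ∈ Set.Icc (0:ℝ) 1} (h i)) → (∀ i, ∀ x ∈ {x : Fin (k + 1) → ℝ | ∀ i, x i ∈ Set.Ioo (0:ℝ) 1}, |h i x| ≤ C) → (∀ i, ∀ x ∈ {x : Fin (k + 1) → ℝ | ∀ i, x i ∈ Set.Ioo (0:ℝ) 1}, DifferentiableAt ℝ (h i) x) → (∀ i, ∀ y ∈ {x : Fin k → ℝ | ∀ i, x i ∈ Set.Ioo (0:ℝ) 1}, ContinuousOn (fun t : ℝ => h i (Fin.insertNth i t y)) (Set.Icc 0 1)) → r.domain = {x : Fin (k + 1) → ℝ | ∀ i, x i ∈ Set.Ioo (0:ℝ) 1} → Set.EqOn r.integrand (fun x => ∑ i, fderiv ℝ (h i) x (Pi.single i 1)) r.domain → (∀ i, (f₀ i).domain = {x : Fin k → ℝ | ∀ i, x i ∈ Set.Ioo (0:ℝ) 1} ∧ (f₁ i).domain = {x : Fin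 k → ℝ | ∀ i, x i ∈ Set.Ioo (0:ℝ) 1} ∧ Set.EqOn (f₀ i).integrand (fun y => h i (Fin.insertNth i 0 y)) {x : Fin k → ℝ | ∀ i, x i ∈ Set.Ioo (0:ℝ) 1} ∧ Set.EqOn (f₁ i).integrand (fun y => h i (Fin.insertNth i 1 y)) {x : Fin k → ℝ | ∀ i, x i ∈ Set.Ioo (0:ℝ) 1}) → Literature.NumberTheory.Transcendental.KZ.of r - ∑ i, (Literature.NumberTheory.Transcendental.KZ.of (f₁ i) - Literature.NumberTheory.Transcendental.KZ.of (f₀ i)) ∈ Literature.NumberTheory.Transcendental.KZ.relations := by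
  intro hBV k h C r f₀ f₁ hsa hC hdiff hcont hrd hri hf
  -- face by face (`∂ᵢhᵢ` is integrable on the open cube by the bounded-variation hypothesis)
  have key : ∀ i, ∃ R : KZ.IntegralRep (k + 1), R.domain = KZ.unitCube (k + 1) ∧
      R.integrand =
        (KZ.unitCube (k + 1)).indicator (fun x => fderiv ℝ (h i) x (Pi.single i 1)) ∧
      KZ.of R - (KZ.of (f₁ i) - KZ.of (f₀ i)) ∈ KZ.relations := fun i =>
    face_move i ((finSuccEquiv' i).trans finSuccEquivLast.symm) (comp_moveLast i)
      (comp_moveLast_symm i) (hsa i) (hdiff i) (hcont i)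
      (hBV k i (h i) C
        ((hsa i).mono (fun x hx j => Ioo_subset_Icc_self (KZ.mem_unitCube.1 hx j))
          (KZ.isSemialgebraic_unitCube _)) (hC i) (hdiff i))
      (f₀ i) (f₁ i) (hf i).1 (hf i).2.1 (hf i).2.2.1 (hf i).2.2.2
  choose R hRd hRi hRrel using key
  -- iterated integrand additivity: `[r] = [Q, 0] + Σᵢ [Q, 𝟙_Q ∂ᵢhᵢ]`
  obtain ⟨R₀, hR₀d, hR₀i⟩ := KZ.exists_zeroRep r.isSemialgebraic_domain
  have ha : KZ.of r - KZ.of R₀ - ∑ i, KZ.of (R i) ∈ KZ.relations := by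
    refine KZ.of_sub_of_sub_sum_mem_relations (k + 1) r R₀ R hR₀d
      (fun i => (hRd i).trans hrd.symm) (fun x hx => ?_)
    have hxQ : x ∈ KZ.unitCube (k + 1) := by rw [hrd] at hx; exact hx
    show r.integrand x = R₀.integrand x + ∑ i, (R i).integrand x
    rw [hri hx, hR₀i]
    simp only [Pi.zero_apply, zero_add, hRi, indicator_of_mem hxQ]
  have h0 : KZ.of R₀ ∈ KZ.relations :=
    KZ.of_mem_relations_of_eqOn_zero R₀ (by rw [hR₀i]; exact fun _ _ => rfl)
  have hsum : ∑ i, (KZ.of (R i) - (KZ.of (f₁ i) - KZ.of (f₀ i))) ∈ KZ.relations :=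
    KZ.relations.sum_mem fun i _ => hRrel i
  have heq : KZ.of r - ∑ i, (KZ.of (f₁ i) - KZ.of (f₀ i)) =
      (KZ.of r - KZ.of R₀ - ∑ i, KZ.of (R i)) + KZ.of R₀ +
        ∑ i, (KZ.of (R i) - (KZ.of (f₁ i) - KZ.of (f₀ i))) := by
    simp only [Finset.sum_sub_distrib]
    abel
  rw [heq]
  exact KZ.relations.add_mem (KZ.relations.add_mem ha h0) hsum

end Summit.KontsevichZagierPeriods.DihedralNormalForm.TameBVStokes
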